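import Summits.ResolutionOfSingularities.ResolutionOfSingularities.Theorems.FrobeniusClosingSteerStrippedChainTwoStep
import Summits.ResolutionOfSingularities.ResolutionOfSingularities.Theorems.FrobeniusClosingSteerRadicandChainTwoRealisation
import HarnessLib

/-!
# Crux `Steer` (stmt-ResolutionOfSingularities-16345), chain W4.1, σ-residual HIGH, §σ2.25 v2 F-A3 at `c = 2`, part 2/2:
# **no eternal STRIPPED isolated radicand chain in dimension two, from Lipman's normalised branch** (Theses-free helper; the step
# lemmas are part 1, `FrobeniusClosingSteerStrippedChainTwoStep.lean`)

OURS (campaign `res-hironaka`, rung L ★L-G4, slot W4.1, chain W4.1, seat `res-D-pv-014` on res-L0-w41-plan-1's RULINGS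
30b / 32b / 37b, 2026-08-27; replaces the role of no printed item; NOT a statement of the manuscript under review; AI review is
weaker than expert review).  FILE 2 of the F-A3(2) discharge: the reduction

  `StrippedChainTwo.noEternalStrippedRadicandChain_two (hL : Lipman1978NoEternalNormalisedBranch) (p) (hp : p.Prime) :
     <NoEternalStrippedRadicandChain p 2>`

of res-D-pv-003's §σ2.25 v2.1 Prop `NoEternalStrippedRadicandChain p c` (delta `L/res-D-pv-003/W41-s25v21-heightsplit.r30.delta.lean`
fc48445925ff776d, VERBATIM at `c = 2`, `RadicandRing` / `HasIsolatedSingularity` unfolded as in K(2)) to FILE 1, res-type-038's NAMED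
FACT `Literature.AlgebraicGeometry.Resolution.Lipman1978NoEternalNormalisedBranch` (Lipman 1978 THEOREM p. 151 + (1.32)–(1.33) p. 174 /
Artin 1986 Thm. (1.1) / Liu 2002 Thm. 8.3.44 followed along one branch of closed points WITH normalisation; predicate
`IsNormalisedQuadraticTransform` = `IsQuadraticTransform` with the chart replaced by its integral closure in `K`).

## The statement

There is no infinite sequence of quadratic transforms `S m → S (m+1)` of excellent regular local rings of dimension TWO inside a field
of characteristic `p`, carrying radicands `f m` with the STRIPPED law `f (m+1) · (x m)^(p · e m) = f m − (g m)^p` (`x m` the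
exceptional parameter, `e m ≥ 1`, `e m ≥ 2` infinitely often), of multiplicity `p` after cleaning, with isolated torsor singularity at
every stage.  (The binders `_he`'s positivity IS used — the step is a point blow-up followed by `e m − 1` strippings; `_hinf` is NOT
used: the theorem holds for every exponent sequence `e m ≥ 1`, in particular it contains K(2).)

## Proof (res-L0-w41-strat-2's NORMALISATION READING 2026-08-27T09:07:40Z; plan-1 RULING 30b)

Realise the torsor germs `T m = (S m)[X]/(X^p − f m)` in ONE field `K′ := Frac(S 0)[X]/(X^p − f 0)` exactly as in K(2)
(`RadicandChainTwo.noEternalIsolatedRadicandChain_two`, p505893 ff.): `θ 0 := X`, **`θ (m+1) := (θ m − g m)/(x m)^(e m)`**, so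
`(θ m)^p = f m` and `θ m = (x m)^(e m) · θ (m+1) + g m`; `R m := ψ(S m)[θ m] ≅ T m` (injective because `T m` is a domain —
isolated, `RadicandChainTwo.isDomain_of_isolated`); `R 0` is a local ring of `K′`, Noetherian, excellent; `dim R m = 2`; every `R m` is
integrally closed (`RadicandChainTwo.isIntegrallyClosed_of_isolated`, Serre-free, transported).  THE STEP IS A NORMALISED QUADRATIC
TRANSFORM (`StrippedChainTwo.isNormalisedQuadraticTransform_adjoin`): with `θ′ := (x m)^(e m − 1) · θ (m+1)` the ring
`Q := ψ(S (m+1))[θ′]` is the `e = 1` strict transform, a QUADRATIC TRANSFORM of `R m` by K(2)'s adjoin step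
`RadicandChainAdjoin.isQuadraticTransform_adjoin` VERBATIM (`θ m = x m · θ′ + g m`, `(θ′)^p = (x m)^(p(e m − 1)) f (m+1) ∈ S (m+1)`);
`Q` is local (its units are the units of the local `R (m+1) ⊇ Q`, which is integral over `Q`); `R (m+1) = ψ(S (m+1))[θ (m+1)]` is
INTEGRAL over `Q ⊇ ψ(S (m+1))`, local, integrally closed, with fraction field `K′` — so it is a normalised quadratic transform of
`R m` (`StrippedChainTwo.isNormalisedQuadraticTransform_of_integral`: `Q` is the localisation of its chart `C` at the elements invertible
in `Q`, so integrality over `Q` clears to integrality over `C`, Mathlib `IsIntegral.exists_multiple_integral_of_isLocalization`; the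
`e m − 1` strippings are swallowed by the normalisation: `R (m+1)` IS the integral closure of `Q`).  Lipman's normalised-branch fact then gives a REGULAR member, contradicting
the cleaned multiplicity `f m − h^p ∈ 𝔪^p ⊆ 𝔪²` (`RadicandChainTwo.not_isRegularLocalRing_of_sub_pow_mem_sq`).
[cite: Lipman1978, Thm. p. 151, (1.32)–(1.33) p. 174] [cite: Artin1986, Thm. (1.1)] [cite: Cutkosky2014, §2.1] [folklore]
-/

noncomputable section

-- `Summit.<S>.<S>.…` duplicates the summit name by design (single-problem summit).
set_option linter.dupNamespace false

open Polynomial IsLocalRing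

namespace Summit.ResolutionOfSingularities.ResolutionOfSingularities.Theorems.SwitchingDichotomy

open Literature.AlgebraicGeometry.Resolution

namespace StrippedChainTwo

/-! ## The realisation and the leaf -/

section Leaf

open RadicandChainTwo

/-- **F-A3(2) — `NoEternalStrippedRadicandChain p 2`, conditional on `Lipman1978NoEternalNormalisedBranch`** (res-D-pv-003's §σ2.25
v2.1 Prop, `L/res-D-pv-003/W41-s25v21-heightsplit.r30.delta.lean` fc48445925ff776d, VERBATIM at `c = 2` with `RadicandRing` /
`HasIsolatedSingularity` unfolded): there is no infinite sequence of quadratic transforms of excellent regular local rings of dimension TWO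
inside a field of characteristic `p`, carrying radicands `f m` with the STRIPPED law `f (m+1) · (x m)^(p · e m) = f m − (g m)^p`
(`x m` the exceptional parameter, `e m ≥ 1`, and `e m ≥ 2` infinitely often — this last binder is not used), of multiplicity `p` after
cleaning, with isolated torsor singularity at every stage.  Proof: realise the torsor germs `T m` as a NORMALISED branch `R m` in the field
`Frac(S 0)[X]/(X^p − f 0)` (module docstring; `θ (m+1) := (θ m − g m)/(x m)^(e m)`, step = `isNormalisedQuadraticTransform_adjoin`) and
apply `false_of_normalisedRealisation`.  By-name leaf for the slate's hS2 slot: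
`fun p hp => StrippedChainTwo.noEternalStrippedRadicandChain_two hL p hp`.
[cite: Lipman1978, Thm. p. 151, (1.32)–(1.33) p. 174] [cite: Artin1986, Thm. (1.1)] [cite: Cutkosky2014, §2.1] [folklore] -/
theorem noEternalStrippedRadicandChain_two (hL : Lipman1978NoEternalNormalisedBranch.{0}) (p : ℕ) (hp : p.Prime) :
    ∀ (L : Type) [Field L] [CharP L p] (S : ℕ → Subring L) [∀ m, IsLocalRing (S m)]
      (hle : ∀ m, S m ≤ S (m + 1)) (f g : ∀ m, S m) (x : ∀ m, S (m + 1)) (e : ℕ → ℕ) (_he : ∀ m, 1 ≤ e m)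
      (_hinf : ∀ m₀, ∃ m, m₀ ≤ m ∧ 2 ≤ e m),
      (∀ m, IsRegularLocalRing (S m)) → (∀ m, IsExcellentRing (S m)) → (∀ m, ringKrullDim (S m) = (2 : ℕ)) →
      (∀ m, IsQuadraticTransform (S m) (S (m + 1))) →
      (∀ m, Ideal.span ((fun y : S m => (⟨(y : L), hle m y.2⟩ : S (m + 1))) ''
          (maximalIdeal (S m) : Set (S m))) = Ideal.span {x m}) →
      (∀ m, ((f (m + 1) : S (m + 1)) : L) * ((x m : S (m + 1)) : L) ^ (p * e m) =
          ((f m : S m) : L) - ((g m : S m) : L) ^ p) →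
      (∀ m, ∃ h : S m, f m - h ^ p ∈ maximalIdeal (S m) ^ p) →
      (∀ m, ∀ (P : Ideal (AdjoinRoot ((X : (S m)[X]) ^ p - C (f m)))) [P.IsPrime],
          (∃ Q : Ideal (AdjoinRoot ((X : (S m)[X]) ^ p - C (f m))), Q.IsPrime ∧ P < Q) →
          IsRegularLocalRing (Localization.AtPrime P)) →
      False := by
  intro L _ _ S _ hle f g x e he _hinf hreg hexc hdim hQT hspan hrel hmult hisol
  classical
  haveI := Fact.mk hp
  have hmon : ∀ m, ((X : (S m)[X]) ^ p - C (f m)).Monic := fun m =>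
    NoEternalChainOne.monic_X_pow_sub_C' p (f m)
  have hTloc : ∀ m, IsLocalRing (AdjoinRoot ((X : (S m)[X]) ^ p - C (f m))) := fun m =>
    isLocalRing_adjoinRoot_X_pow_sub_C_of_charP p (f m)
  have hTdom : ∀ m, IsDomain (AdjoinRoot ((X : (S m)[X]) ^ p - C (f m))) := fun m =>
    haveI := hreg m
    isDomain_of_isolated p (f m) (hdim m) (hisol m)
  have hx0 : ∀ m, ((x m : S (m + 1)) : L) ≠ 0 := by
    intro m hxm
    haveI := hreg m
    have hbot : maximalIdeal (S m) = ⊥ := by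
      rw [eq_bot_iff]
      intro y hy
      have h1 : (⟨(y : L), hle m y.2⟩ : S (m + 1)) ∈ Ideal.span {x m} :=
        hspan m ▸ Ideal.subset_span ⟨y, hy, rfl⟩
      obtain ⟨a, ha⟩ := Ideal.mem_span_singleton'.mp h1
      have h2 : (y : L) = 0 := by
        rw [← congrArg Subtype.val ha]
        show ((a : S (m + 1)) : L) * ((x m : S (m + 1)) : L) = 0
        rw [hxm, mul_zero]
      exact (Submodule.mem_bot _).mpr (Subtype.ext h2)
    have h0 := ringKrullDim_eq_zero_of_isField ((isField_iff_maximalIdeal_eq).mpr hbot)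
    rw [hdim m] at h0
    have h2 : (2 : ℕ) = 0 := by exact_mod_cast h0
    exact absurd h2 two_ne_zero
  set L₀ : Subfield L := Subfield.closure ((S 0 : Subring L) : Set L) with hL₀
  have hSL₀ : ∀ m, ∀ z ∈ S m, z ∈ L₀ := mem_subfield_closure_of_chain S hQT
  let ι : L₀ →+* L := L₀.subtype
  have hιrange : ∀ m, S m ≤ ι.range := fun m z hz => ⟨⟨z, hSL₀ m z hz⟩, rfl⟩
  haveI : CharP L₀ p := RingHom.charP L₀.subtype L₀.subtype.injective p
  let f' : ∀ m, L₀ := fun m => ⟨((f m : S m) : L), hSL₀ m _ (f m).2⟩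
  let g' : ∀ m, L₀ := fun m => ⟨((g m : S m) : L), hSL₀ m _ (g m).2⟩
  let x' : ∀ m, L₀ := fun m => ⟨((x m : S (m + 1)) : L), hSL₀ (m + 1) _ (x m).2⟩
  have hrel' : ∀ m, f' (m + 1) * x' m ^ (p * e m) = f' m - g' m ^ p := fun m => Subtype.ext (hrel m)
  have hx'0 : ∀ m, x' m ≠ 0 := fun m h => hx0 m (congrArg Subtype.val h)
  set F₀ : L₀[X] := (X : L₀[X]) ^ p - C (f' 0) with hF₀
  have hirr : Irreducible F₀ := by
    refine X_pow_sub_C_irreducible_of_prime hp fun b hb => ?_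
    obtain ⟨a, ha, c, hc, hbac⟩ := exists_div_eq_of_mem_subfield_closure (S 0) b.2
    haveI := hreg 0
    rcases eq_or_ne c 0 with rfl | hc0
    · -- `b = a/0 = 0`, so `f 0 = 0 = 0^p`
      have hb0 : b = 0 := Subtype.ext (by rw [hbac, div_zero]; rfl)
      rw [hb0, zero_pow hp.ne_zero] at hb
      have hf0 : f 0 = 0 := Subtype.ext (congrArg Subtype.val hb).symm
      refine pow_mul_ne_pow p (f 0) (hdim 0) (hisol 0) 0 1 one_ne_zero ?_
      rw [hf0, mul_zero, zero_pow hp.ne_zero]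
    · refine pow_mul_ne_pow p (f 0) (hdim 0) (hisol 0) ⟨a, ha⟩ ⟨c, hc⟩
        (fun h => hc0 (congrArg Subtype.val h)) (Subtype.ext ?_)
      have hbL : (b : L) ^ p = ((f 0 : S 0) : L) := congrArg Subtype.val hb
      show c ^ p * ((f 0 : S 0) : L) = a ^ p
      rw [← hbL, hbac, div_pow, mul_div_cancel₀ _ (pow_ne_zero p hc0)]
  haveI : Fact (Irreducible F₀) := ⟨hirr⟩
  let ψ : L₀ →+* AdjoinRoot F₀ := AdjoinRoot.of F₀
  have hψ : Function.Injective ψ := (AdjoinRoot.of F₀).injective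
  haveI : CharP (AdjoinRoot F₀) p := charP_of_injective_ringHom hψ p
  have hψx0 : ∀ m, ψ (x' m) ≠ 0 := fun m h => hx'0 m (hψ (by rw [h, map_zero]))
  -- ### the STRIPPED torsor generators: `θ (m+1) = (θ m − g m) / (x m)^(e m)`
  let θ : ℕ → AdjoinRoot F₀ := fun m =>
    Nat.rec (AdjoinRoot.root F₀) (fun m t => (t - ψ (g' m)) / ψ (x' m) ^ e m) m
  have hθsucc : ∀ m, θ (m + 1) = (θ m - ψ (g' m)) / ψ (x' m) ^ e m := fun m => rfl
  have hθpow : ∀ m, θ m ^ p = ψ (f' m) := by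
    intro m
    induction m with
    | zero =>
      have h := AdjoinRoot.eval₂_root F₀
      rw [hF₀, eval₂_sub, eval₂_X_pow, eval₂_C, sub_eq_zero] at h
      exact h
    | succ m ih =>
      rw [hθsucc, div_pow, sub_pow_char, ih, ← map_pow, ← map_sub, ← hrel' m, map_mul, map_pow,
        pow_mul', mul_div_cancel_right₀ _ (pow_ne_zero p (pow_ne_zero _ (hψx0 m)))]
  have hθrel : ∀ m, θ m = ψ (x' m) ^ e m * θ (m + 1) + ψ (g' m) := by
    intro m
    rw [hθsucc, mul_div_cancel₀ _ (pow_ne_zero _ (hψx0 m)), sub_add_cancel]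
  have heA : ∀ m, ∃ eqv : S m ≃+* ((S m).comap ι).map ψ, ∀ s : S m, (eqv s : AdjoinRoot F₀) =
      ψ ⟨(s : L), hSL₀ m _ s.2⟩ := fun m =>
    exists_ringEquiv_comap_map ι ψ (S m) (fun s => ⟨(s : L), hSL₀ m _ s.2⟩) (fun _ => rfl)
  choose eA heAval using heA
  have hAloc : ∀ m, IsLocalRing (((S m).comap ι).map ψ) := fun m => (eA m).isLocalRing
  let φ : ∀ m, S m →+* AdjoinRoot F₀ := fun m =>
    (Subring.subtype (((S m).comap ι).map ψ)).comp (eA m).toRingHom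
  have hφval : ∀ m (s : S m), φ m s = ψ ⟨(s : L), hSL₀ m _ s.2⟩ := fun m s => heAval m s
  have hφinj : ∀ m, Function.Injective (φ m) := fun m =>
    (Subring.subtype_injective _).comp (eA m).injective
  have hφrange : ∀ m, (φ m).range = ((S m).comap ι).map ψ := by
    intro m
    ext z
    constructor
    · rintro ⟨s, rfl⟩
      exact (eA m s).2
    · intro hz
      refine ⟨(eA m).symm ⟨z, hz⟩, ?_⟩
      show (((eA m) ((eA m).symm ⟨z, hz⟩) : ((S m).comap ι).map ψ) : AdjoinRoot F₀) = z
      rw [(eA m).apply_symm_apply]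
  have hFθ : ∀ m, ((X : (S m)[X]) ^ p - C (f m)).eval₂ (φ m) (θ m) = 0 := by
    intro m
    rw [eval₂_sub, eval₂_X_pow, eval₂_C, hθpow, hφval, sub_eq_zero]
  let τ : ∀ m, AdjoinRoot ((X : (S m)[X]) ^ p - C (f m)) →+* AdjoinRoot F₀ := fun m =>
    AdjoinRoot.lift (φ m) (θ m) (hFθ m)
  let R : ℕ → Subring (AdjoinRoot F₀) := fun m =>
    Subring.closure (((((S m).comap ι).map ψ : Subring (AdjoinRoot F₀)) : Set (AdjoinRoot F₀)) ∪ {θ m})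
  have hτrange : ∀ m, (τ m).range = R m := by
    intro m
    show (AdjoinRoot.lift (φ m) (θ m) (hFθ m)).range = _
    rw [RadicandChainAdjoin.range_adjoinRoot_lift, hφrange]
  have hτinj : ∀ m, Function.Injective (τ m) := by
    intro m
    haveI := hreg m
    haveI := hTdom m
    haveI : Module.Finite (S m) (AdjoinRoot ((X : (S m)[X]) ^ p - C (f m))) := (hmon m).finite_adjoinRoot
    haveI : Algebra.IsIntegral (S m) (AdjoinRoot ((X : (S m)[X]) ^ p - C (f m))) := inferInstance
    have hker : RingHom.ker (τ m) = ⊥ := by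
      apply Ideal.eq_bot_of_comap_eq_bot (R := S m)
      rw [eq_bot_iff]
      intro s hs
      rw [Ideal.mem_comap, RingHom.mem_ker, AdjoinRoot.algebraMap_eq] at hs
      have h1 : φ m s = 0 := by
        rw [← hs]
        exact (AdjoinRoot.lift_of (hFθ m)).symm
      exact (Submodule.mem_bot _).mpr ((injective_iff_map_eq_zero (φ m)).mp (hφinj m) s h1)
    exact (RingHom.injective_iff_ker_eq_bot _).mpr hker
  have hequiv : ∀ m, ∃ eqv : AdjoinRoot ((X : (S m)[X]) ^ p - C (f m)) ≃+* R m,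
      ∀ t, (eqv t : AdjoinRoot F₀) = τ m t := by
    intro m
    have hbij : Function.Bijective (τ m).rangeRestrict :=
      ⟨fun a b h => hτinj m (congrArg Subtype.val h), RingHom.rangeRestrict_surjective _⟩
    exact ⟨(RingEquiv.ofBijective (τ m).rangeRestrict hbij).trans (RingEquiv.subringCongr (hτrange m)),
      fun t => rfl⟩
  choose eqv heqv using hequiv
  have hRloc : ∀ m, IsLocalRing (R m) := fun m =>
    haveI := hTloc m
    (eqv m).isLocalRing
  have hAR : ∀ {m} {z}, z ∈ ((S m).comap ι).map ψ → z ∈ R m := fun hz =>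
    Subring.subset_closure (Or.inl hz)
  have hθR : ∀ m, θ m ∈ R m := fun m => Subring.subset_closure (Or.inr rfl)
  -- ### every element of `K' = L₀[θ 0]` is a fraction over `R 0`
  have hR0frac : ∀ z : AdjoinRoot F₀, ∃ a ∈ R 0, ∃ b ∈ R 0, b ≠ 0 ∧ z = a / b := by
    have good_add : ∀ z w : AdjoinRoot F₀,
        (∃ a ∈ R 0, ∃ b ∈ R 0, b ≠ 0 ∧ z = a / b) → (∃ a ∈ R 0, ∃ b ∈ R 0, b ≠ 0 ∧ w = a / b) →
        (∃ a ∈ R 0, ∃ b ∈ R 0, b ≠ 0 ∧ z + w = a / b) := by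
      rintro z w ⟨a, ha, b, hb, hb0, rfl⟩ ⟨c, hc, d, hd, hd0, rfl⟩
      exact ⟨a * d + b * c, add_mem (mul_mem ha hd) (mul_mem hb hc), b * d, mul_mem hb hd,
        mul_ne_zero hb0 hd0, div_add_div a c hb0 hd0⟩
    have good_mul : ∀ z w : AdjoinRoot F₀,
        (∃ a ∈ R 0, ∃ b ∈ R 0, b ≠ 0 ∧ z = a / b) → (∃ a ∈ R 0, ∃ b ∈ R 0, b ≠ 0 ∧ w = a / b) →
        (∃ a ∈ R 0, ∃ b ∈ R 0, b ≠ 0 ∧ z * w = a / b) := by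
      rintro z w ⟨a, ha, b, hb, hb0, rfl⟩ ⟨c, hc, d, hd, hd0, rfl⟩
      exact ⟨a * c, mul_mem ha hc, b * d, mul_mem hb hd, mul_ne_zero hb0 hd0, div_mul_div_comm a b c d⟩
    have good_of_mem : ∀ z ∈ R 0, ∃ a ∈ R 0, ∃ b ∈ R 0, b ≠ 0 ∧ z = a / b :=
      fun z hz => ⟨z, hz, 1, one_mem _, one_ne_zero, (div_one z).symm⟩
    have good_ψ : ∀ u : L₀, ∃ a ∈ R 0, ∃ b ∈ R 0, b ≠ 0 ∧ ψ u = a / b := by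
      intro u
      obtain ⟨a, ha, c, hc, huac⟩ := exists_div_eq_of_mem_subfield_closure (S 0) u.2
      have haR : ψ ⟨a, hSL₀ 0 a ha⟩ ∈ R 0 := hAR (by rw [← hφval 0 ⟨a, ha⟩]; exact (hφrange 0) ▸ ⟨_, rfl⟩)
      have hcR : ψ ⟨c, hSL₀ 0 c hc⟩ ∈ R 0 := hAR (by rw [← hφval 0 ⟨c, hc⟩]; exact (hφrange 0) ▸ ⟨_, rfl⟩)
      rcases eq_or_ne c 0 with rfl | hc0
      · have hu0 : u = 0 := Subtype.ext (by rw [huac, div_zero]; rfl)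
        rw [hu0, map_zero]
        exact ⟨0, zero_mem _, 1, one_mem _, one_ne_zero, (div_one 0).symm⟩
      · refine ⟨_, haR, _, hcR, fun h => hc0 ?_, ?_⟩
        · have := hψ (h.trans (map_zero ψ).symm)
          exact congrArg Subtype.val this
        · rw [← map_div₀]
          congr 1
          exact Subtype.ext huac
    intro z
    obtain ⟨q, rfl⟩ := AdjoinRoot.mk_surjective z
    rw [← AdjoinRoot.aeval_eq, aeval_def, AdjoinRoot.algebraMap_eq]
    induction q using Polynomial.induction_on with
    | C u =>
      rw [eval₂_C]
      exact good_ψ u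
    | add q₁ q₂ h₁ h₂ =>
      rw [eval₂_add]
      exact good_add _ _ h₁ h₂
    | monomial n u _ =>
      rw [eval₂_mul, eval₂_C, eval₂_X_pow]
      exact good_mul _ _ (good_ψ u) (good_of_mem _ (pow_mem (hθR 0) (n + 1)))
  -- ### the branch is increasing, so every member has fraction field `K'`
  have hAmono : ∀ m, ((S m).comap ι).map ψ ≤ ((S (m + 1)).comap ι).map ψ := fun m =>
    (RadicandChainTransport.isQuadraticTransform_transport ι ψ (hQT m) (hιrange (m + 1))).dominates.1
  have hRmono : ∀ m, R m ≤ R (m + 1) := by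
    intro m
    refine Subring.closure_le.mpr ?_
    rintro z (hz | hz)
    · exact hAR (hAmono m hz)
    · rw [Set.mem_singleton_iff] at hz
      rw [hz, hθrel m]
      refine (R (m + 1)).add_mem ((R (m + 1)).mul_mem ((R (m + 1)).pow_mem (hAR ?_) _) (hθR (m + 1)))
        (hAR (hAmono m ?_))
      · rw [← hφval (m + 1) (x m)]; exact (hφrange (m + 1)) ▸ ⟨_, rfl⟩
      · rw [← hφval m (g m)]; exact (hφrange m) ▸ ⟨_, rfl⟩
  have hR0le : ∀ m, R 0 ≤ R m := by
    intro m
    induction m with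
    | zero => exact le_rfl
    | succ m ih => exact ih.trans (hRmono m)
  have hRfrac : ∀ m, ∀ z : AdjoinRoot F₀, ∃ a ∈ R m, ∃ b ∈ R m, b ≠ 0 ∧ z = a / b := by
    intro m z
    obtain ⟨a, ha, b, hb, hb0, rfl⟩ := hR0frac z
    exact ⟨a, hR0le m ha, b, hR0le m hb, hb0, rfl⟩
  refine false_of_normalisedRealisation hL S f hreg hdim hmult hisol R eqv ⟨hRloc 0, hR0frac⟩ ?_ ?_ ?_ ?_
  · -- Noetherian
    haveI : IsNoetherianRing (AdjoinRoot ((X : (S 0)[X]) ^ p - C (f 0))) :=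
      inferInstanceAs (IsNoetherianRing ((S 0)[X] ⧸ Ideal.span {(X : (S 0)[X]) ^ p - C (f 0)}))
    exact isNoetherianRing_of_ringEquiv _ (eqv 0)
  · -- excellent
    haveI : Module.Finite (S 0) (AdjoinRoot ((X : (S 0)[X]) ^ p - C (f 0))) := (hmon 0).finite_adjoinRoot
    exact ((hexc 0).of_finiteType' (B := AdjoinRoot ((X : (S 0)[X]) ^ p - C (f 0)))).of_ringEquiv (eqv 0)
  · -- NORMALISED quadratic transforms
    intro m
    haveI := hAloc m
    haveI := hAloc (m + 1)
    haveI := hRloc m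
    haveI := hRloc (m + 1)
    have hAQ : IsQuadraticTransform (((S m).comap ι).map ψ) (((S (m + 1)).comap ι).map ψ) :=
      RadicandChainTransport.isQuadraticTransform_transport ι ψ (hQT m) (hιrange (m + 1))
    have hleA : ((S m).comap ι).map ψ ≤ ((S (m + 1)).comap ι).map ψ := hAQ.dominates.1
    have hcomp : ∀ y : S m, ((eA (m + 1)) ⟨(y : L), hle m y.2⟩ : AdjoinRoot F₀) = (eA m y : AdjoinRoot F₀) := by
      intro y
      rw [heAval, heAval]
    have hspanA := RadicandChainTransport.span_maximalIdeal_transport (hle m) hleA (eA m) (eA (m + 1))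
      hcomp (x m) (hspan m)
    have hnormR : IsIntegrallyClosed (R (m + 1)) := by
      haveI := hreg (m + 1)
      haveI : IsIntegrallyClosed (AdjoinRoot ((X : (S (m + 1))[X]) ^ p - C (f (m + 1)))) :=
        isIntegrallyClosed_of_isolated p (f (m + 1)) (hdim (m + 1)) (hisol (m + 1))
      exact IsIntegrallyClosed.of_equiv (eqv (m + 1))
    refine isNormalisedQuadraticTransform_adjoin hAQ hleA hp.ne_zero
      (eA m (f m)) (eA m (g m)) (eA (m + 1) (f (m + 1))) (eA (m + 1) (x m)) (e m - 1) ?_ ?_ ?_ hspanA rfl rfl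
      hnormR (hRfrac (m + 1))
    · rw [heAval]; exact hθpow m
    · rw [heAval]; exact hθpow (m + 1)
    · rw [heAval, heAval, Nat.sub_add_cancel (he m)]; exact hθrel m
  · -- dimension two
    intro m
    haveI := hreg m
    haveI := hTdom m
    haveI : Module.Finite (S m) (AdjoinRoot ((X : (S m)[X]) ^ p - C (f m))) := (hmon m).finite_adjoinRoot
    haveI : Module.Free (S m) (AdjoinRoot ((X : (S m)[X]) ^ p - C (f m))) := (hmon m).free_adjoinRoot
    haveI : Algebra.IsIntegral (S m) (AdjoinRoot ((X : (S m)[X]) ^ p - C (f m))) := inferInstance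
    haveI : FaithfulSMul (S m) (AdjoinRoot ((X : (S m)[X]) ^ p - C (f m))) := inferInstance
    rw [← ringKrullDim_eq_of_ringEquiv (eqv m),
      ringKrullDim_eq_of_isIntegral (FaithfulSMul.algebraMap_injective (S m) _)]
    exact hdim m

end Leaf

end StrippedChainTwo

end Summit.ResolutionOfSingularities.ResolutionOfSingularities.Theorems.SwitchingDichotomy

end
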